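import Summits.BirchSwinnertonDyer.BirchSwinnertonDyer.Theorems.AdditiveKolyvaginRoadManinFrameResidueProperRTameTwistSplit
import HarnessLib

/-!
# Route `AdditiveKolyvaginRoad`, crux `ManinFrameResidueProperR` (stmt-BirchSwinnertonDyer-20709), line
# `birth`, stub TDS: splitting `γ⁴ = γ₁ γ₂` into 4-ADJUSTABLE elements of `Γ₀(N)` — `--supports`, helper

Cell `pub/bsd-wall`, seat `bsd-wall-manin-p1` g3. Companion of `…RTameTwistMod4.lean` (4-adjustable = adjustable
∧ (`4 ∣ c ⟹ d ≡ 3 (mod 4)`)). `exists_eq_mul_adjustable4`: for a prime `p ≥ 5` dividing `N`, every `γ ∈ Γ₀(N)`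
with `c ≠ 0`, (`3 ∣ p − 1`, `3 ∣ c` ⟹ `d ≡ 1 (3)`) and (`4 ∣ c` ⟹ `d ≡ 1 (4)`) is a product of two 4-adjustable
elements: as in `…RTameTwistSplit` with the extra residue `d₂ ≡ 3d (mod 4)` (`d` odd; else `1`) in the CRT, the
verification `4 ∣ c₁ ⟹ d₁ ≡ 3 (4)` being the identity `d₁d₂ − d = cv(d₂ − d)` read in `ℤ/4` (`decide`).
`four_dvd_pow_four_entry`: `4 ∣ (γ⁴)₁₀ ⟹ (γ⁴)₁₁ ≡ 1 (4)` for all `γ ∈ SL(2, ℤ)` (a check in `SL₂(ℤ/4)`).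
Everything proved; no definition.
-/

set_option autoImplicit false
set_option linter.dupNamespace false

noncomputable section

open scoped MatrixGroups Classical

open CongruenceSubgroup Matrix

namespace Summit.BirchSwinnertonDyer.BirchSwinnertonDyer.Theorems.ManinFrameResidueProperRTameTwist

section Splitting4

variable {N : ℕ} {p : ℕ}

/-- **Splitting into 4-adjustable factors** (see the module docstring). [folklore] -/
theorem exists_eq_mul_adjustable4 (hp : p.Prime) (hp5 : 5 ≤ p) (hpN : p ∣ N) (γ : Gamma0 N)
    (hc : (γ : SL(2, ℤ)) 1 0 ≠ 0)
    (h3 : 3 ∣ p - 1 → (3 : ℤ) ∣ (γ : SL(2, ℤ)) 1 0 → (3 : ℤ) ∣ (γ : SL(2, ℤ)) 1 1 - 1)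
    (h4 : (4 : ℤ) ∣ (γ : SL(2, ℤ)) 1 0 → (4 : ℤ) ∣ (γ : SL(2, ℤ)) 1 1 - 1) :
    ∃ γ₁ γ₂ : Gamma0 N, γ = γ₁ * γ₂ ∧
      ((γ₁ : SL(2, ℤ)) 1 0 ≠ 0 ∧ ¬ (p : ℤ) ∣ (γ₁ : SL(2, ℤ)) 1 1 - 1 ∧
        (∀ r : ℕ, r.Prime → r ≠ 2 → r ∣ p - 1 → (r : ℤ) ∣ (γ₁ : SL(2, ℤ)) 1 0 →
          ¬ (r : ℤ) ∣ (γ₁ : SL(2, ℤ)) 1 1 - 1) ∧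
        ((4 : ℤ) ∣ (γ₁ : SL(2, ℤ)) 1 0 → (4 : ℤ) ∣ (γ₁ : SL(2, ℤ)) 1 1 - 3)) ∧
      ((γ₂ : SL(2, ℤ)) 1 0 ≠ 0 ∧ ¬ (p : ℤ) ∣ (γ₂ : SL(2, ℤ)) 1 1 - 1 ∧
        (∀ r : ℕ, r.Prime → r ≠ 2 → r ∣ p - 1 → (r : ℤ) ∣ (γ₂ : SL(2, ℤ)) 1 0 →
          ¬ (r : ℤ) ∣ (γ₂ : SL(2, ℤ)) 1 1 - 1) ∧
        ((4 : ℤ) ∣ (γ₂ : SL(2, ℤ)) 1 0 → (4 : ℤ) ∣ (γ₂ : SL(2, ℤ)) 1 1 - 3)) := by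
  have hp2 : p ≠ 2 := by omega
  have hpc : (p : ℤ) ∣ (γ : SL(2, ℤ)) 1 0 :=
    (Int.natCast_dvd_natCast.mpr hpN).trans (natCast_dvd_entry10 γ)
  -- the primes at which residues are prescribed
  set S : Finset ℕ := insert p ((p - 1).primeFactors.erase 2) with hSdef
  have hSprime : ∀ q ∈ S, q.Prime ∧ q ≠ 2 := by
    intro q hq
    rcases Finset.mem_insert.mp hq with rfl | hq
    · exact ⟨hp, hp2⟩
    · exact ⟨Nat.prime_of_mem_primeFactors (Finset.mem_of_mem_erase hq), Finset.ne_of_mem_erase hq⟩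
  have hS3 : ∀ q ∈ S, q = 3 → (q : ℤ) ∣ (γ : SL(2, ℤ)) 1 0 → (q : ℤ) ∣ (γ : SL(2, ℤ)) 1 1 - 1 := by
    intro q hq hq3 hqc
    subst hq3
    rcases Finset.mem_insert.mp hq with h | h
    · omega
    · exact h3 (Nat.dvd_of_mem_primeFactors (Finset.mem_of_mem_erase h)) hqc
  -- residues and CRT
  have hres : ∀ q ∈ S, ∃ x : ℕ, ¬ (q : ℤ) ∣ x ∧ ¬ (q : ℤ) ∣ (x : ℤ) - (γ : SL(2, ℤ)) 1 1 ∧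
      ((q : ℤ) ∣ (γ : SL(2, ℤ)) 1 0 → ¬ (q : ℤ) ∣ (x : ℤ) - 1) := fun q hq ↦
    exists_residue q (hSprime q hq).1 (hSprime q hq).2 _ _ (hS3 q hq)
  let xr : ℕ → ℕ := fun q ↦ if hq : q ∈ S then Classical.choose (hres q hq) else 0
  have hxr : ∀ q ∈ S, ¬ (q : ℤ) ∣ xr q ∧ ¬ (q : ℤ) ∣ (xr q : ℤ) - (γ : SL(2, ℤ)) 1 1 ∧
      ((q : ℤ) ∣ (γ : SL(2, ℤ)) 1 0 → ¬ (q : ℤ) ∣ (xr q : ℤ) - 1) := by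
    intro q hq
    simp only [xr, dif_pos hq]
    exact Classical.choose_spec (hres q hq)
  have hS0 : ∀ q ∈ S, (q : ℕ) ≠ 0 := fun q hq ↦ (hSprime q hq).1.ne_zero
  -- the residue modulo `4`: `3` if `d ≡ 1 (mod 4)`, else `1`
  have h4S : (4 : ℕ) ∉ S := fun h ↦ by have := (hSprime 4 h).1; exact absurd this (by decide)
  set S' : Finset ℕ := insert 4 S with hS'def
  let r₄ : ℕ := if (4 : ℤ) ∣ (γ : SL(2, ℤ)) 1 1 - 1 then 3 else 1
  let xr' : ℕ → ℕ := fun q ↦ if q = 4 then r₄ else xr q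
  have hxr'S : ∀ q ∈ S, xr' q = xr q := fun q hq ↦ by
    simp only [xr']; rw [if_neg]; rintro rfl; exact h4S hq
  have hS'0 : ∀ q ∈ S', (q : ℕ) ≠ 0 := fun q hq ↦ by
    rcases Finset.mem_insert.mp hq with rfl | hq
    · norm_num
    · exact hS0 q hq
  have hS'pair : Set.Pairwise (S' : Set ℕ) (Function.onFun Nat.Coprime fun q ↦ q) := by
    intro q hq q' hq' hne
    have hodd : ∀ r ∈ S, Nat.Coprime 4 r := fun r hr ↦ by
      have h2 : Nat.Coprime 2 r := Nat.coprime_two_left.mpr ((hSprime r hr).1.odd_of_ne_two (hSprime r hr).2)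
      simpa using h2.pow_left 2
    rcases Finset.mem_insert.mp hq with rfl | hq <;> rcases Finset.mem_insert.mp hq' with rfl | hq'
    · exact absurd rfl hne
    · exact hodd q' hq'
    · exact (hodd q hq).symm
    · exact (Nat.coprime_primes (hSprime q hq).1 (hSprime q' hq').1).mpr hne
  obtain ⟨x₀, hx₀⟩ := Nat.chineseRemainderOfFinset xr' (fun q ↦ q) S' hS'0 hS'pair
  set M : ℕ := ∏ q ∈ S', q with hMdef
  have hM0 : M ≠ 0 := Finset.prod_ne_zero_iff.mpr hS'0
  have hx₀M : x₀.Coprime M := by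
    refine Nat.Coprime.prod_right fun q hq ↦ ?_
    rcases Finset.mem_insert.mp hq with rfl | hqS
    · -- modulo `4`: `x₀ ≡ r₄ ∈ {1, 3}`
      have h1 : x₀ ≡ r₄ [MOD 4] := by simpa [xr'] using hx₀ 4 hq
      have hr₄ : r₄ = 3 ∨ r₄ = 1 := by simp only [r₄]; split_ifs <;> simp
      have hodd : Odd x₀ := by
        rw [Nat.odd_iff]
        have h2 : x₀ % 4 = r₄ % 4 := h1
        rcases hr₄ with h | h <;> rw [h] at h2 <;> omega
      simpa using (Nat.coprime_two_left.mpr hodd).symm.pow_right 2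
    · refine Nat.coprime_comm.mp (((hSprime q hqS).1.coprime_iff_not_dvd).mpr fun h ↦ (hxr q hqS).1 ?_)
      have h1 : (q : ℤ) ∣ (x₀ : ℤ) - xr q := by
        have := (Nat.modEq_iff_dvd.mp (hx₀ q hq))
        rw [hxr'S q hqS] at this
        rwa [dvd_sub_comm] at this
      have h2 : (q : ℤ) ∣ (x₀ : ℤ) := by exact_mod_cast h
      have := dvd_sub h2 h1
      rwa [sub_sub_cancel] at this
  -- Dirichlet: a prime `d₂ > |c|` in the class `x₀ (mod M)`
  obtain ⟨d₂, hd₂c, hd₂p, hd₂x⟩ :=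
    Nat.forall_exists_prime_gt_and_modEq ((γ : SL(2, ℤ)) 1 0).natAbs hM0 hx₀M
  have hd₂q : ∀ q ∈ S, (q : ℤ) ∣ (d₂ : ℤ) - xr q := by
    intro q hq
    have h1 : d₂ ≡ xr q [MOD q] := by
      have := (Nat.ModEq.of_dvd (Finset.dvd_prod_of_mem _ (Finset.mem_insert_of_mem hq)) hd₂x).trans
        (hx₀ q (Finset.mem_insert_of_mem hq))
      rwa [hxr'S q hq] at this
    have := Nat.modEq_iff_dvd.mp h1
    rwa [dvd_sub_comm] at this
  have hd₂4 : (4 : ℤ) ∣ (d₂ : ℤ) - r₄ := by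
    have h1 : d₂ ≡ r₄ [MOD 4] := by
      have := (Nat.ModEq.of_dvd (Finset.dvd_prod_of_mem _ (Finset.mem_insert_self 4 S)) hd₂x).trans
        (hx₀ 4 (Finset.mem_insert_self 4 S))
      simpa [xr'] using this
    have := Nat.modEq_iff_dvd.mp h1
    rw [dvd_sub_comm] at this
    exact_mod_cast this
  -- the two key non-divisibilities modulo `q ∈ S`
  have hd₂d : ∀ q ∈ S, ¬ (q : ℤ) ∣ (d₂ : ℤ) - (γ : SL(2, ℤ)) 1 1 := by
    intro q hq h
    apply (hxr q hq).2.1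
    rw [show (xr q : ℤ) - (γ : SL(2, ℤ)) 1 1 = ((d₂ : ℤ) - (γ : SL(2, ℤ)) 1 1) - ((d₂ : ℤ) - xr q)
      by ring]
    exact dvd_sub h (hd₂q q hq)
  have hd₂1 : ∀ q ∈ S, (q : ℤ) ∣ (γ : SL(2, ℤ)) 1 0 → ¬ (q : ℤ) ∣ (d₂ : ℤ) - 1 := by
    intro q hq hqc h
    apply (hxr q hq).2.2 hqc
    rw [show (xr q : ℤ) - 1 = ((d₂ : ℤ) - 1) - ((d₂ : ℤ) - xr q) by ring]
    exact dvd_sub h (hd₂q q hq)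
  -- `gcd(d₂, c) = 1` and Bezout
  have hcop : IsCoprime (d₂ : ℤ) ((γ : SL(2, ℤ)) 1 0) := by
    refine Literature.NumberTheory.ModularForms.OrdinaryCusps.isCoprime_natCast_of_not_dvd hd₂p fun h ↦ ?_
    exact Nat.not_dvd_of_pos_of_lt (Int.natAbs_pos.mpr hc) hd₂c (Int.natCast_dvd.mp h)
  obtain ⟨u, v, huv⟩ := hcop
  -- the matrix `γ₂ = (u, −v; c, d₂)`
  let M₂ : SL(2, ℤ) := ⟨!![u, -v; (γ : SL(2, ℤ)) 1 0, (d₂ : ℤ)], by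
    rw [Matrix.det_fin_two_of]; linear_combination huv⟩
  have hM₂ : M₂ ∈ Gamma0 N := by
    rw [Gamma0_mem]
    exact Gamma0_mem.mp γ.2
  let γ₂ : Gamma0 N := ⟨M₂, hM₂⟩
  let γ₁ : Gamma0 N := γ * γ₂⁻¹
  -- entries
  have e2_10 : ((γ₂ : SL(2, ℤ)) 1 0 : ℤ) = (γ : SL(2, ℤ)) 1 0 := rfl
  have e2_11 : ((γ₂ : SL(2, ℤ)) 1 1 : ℤ) = d₂ := rfl
  have hmat : ∀ i j : Fin 2, ((γ₁ : SL(2, ℤ)) i j : ℤ) =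
      ((γ : SL(2, ℤ)).1 * M₂.1.adjugate) i j := fun _ _ ↦ rfl
  have e1_10 : ((γ₁ : SL(2, ℤ)) 1 0 : ℤ) = (γ : SL(2, ℤ)) 1 0 * ((d₂ : ℤ) - (γ : SL(2, ℤ)) 1 1) := by
    rw [hmat]
    simp only [M₂, Matrix.adjugate_fin_two_of, Matrix.mul_apply, Fin.sum_univ_two, Matrix.of_apply,
      Matrix.cons_val', Matrix.cons_val_zero, Matrix.cons_val_one]
    ring
  have e1_11 : ((γ₁ : SL(2, ℤ)) 1 1 : ℤ) = (γ : SL(2, ℤ)) 1 0 * v + (γ : SL(2, ℤ)) 1 1 * u := by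
    rw [hmat]
    simp only [M₂, Matrix.adjugate_fin_two_of, Matrix.mul_apply, Fin.sum_univ_two, Matrix.of_apply,
      Matrix.cons_val', Matrix.cons_val_zero, Matrix.cons_val_one, neg_neg]
  -- `d₁ d₂ − d = c v (d₂ − d)`: a prime dividing `c` and `d₁ − 1` divides `d₂ − d`
  have hkey : ∀ q : ℕ, (q : ℤ) ∣ (γ : SL(2, ℤ)) 1 0 →
      (q : ℤ) ∣ ((γ : SL(2, ℤ)) 1 0 * v + (γ : SL(2, ℤ)) 1 1 * u) - 1 →
      (q : ℤ) ∣ (d₂ : ℤ) - (γ : SL(2, ℤ)) 1 1 := by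
    intro q hqc h
    have hid : (d₂ : ℤ) - (γ : SL(2, ℤ)) 1 1 =
        (γ : SL(2, ℤ)) 1 0 * (v * ((d₂ : ℤ) - (γ : SL(2, ℤ)) 1 1)) -
          (((γ : SL(2, ℤ)) 1 0 * v + (γ : SL(2, ℤ)) 1 1 * u) - 1) * d₂ := by
      linear_combination (γ : SL(2, ℤ)) 1 1 * huv
    rw [hid]
    exact dvd_sub (hqc.trans (dvd_mul_right _ _)) (h.trans (dvd_mul_right _ _))
  have hpS : p ∈ S := Finset.mem_insert_self _ _
  have hrS : ∀ r : ℕ, r.Prime → r ≠ 2 → r ∣ p - 1 → r ∈ S := fun r hr hr2 hrp ↦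
    Finset.mem_insert_of_mem (Finset.mem_erase.mpr ⟨hr2,
      Nat.mem_primeFactors.mpr ⟨hr, hrp, Nat.sub_ne_zero_of_lt hp.one_lt⟩⟩)
  -- the mod-`4` bookkeeping: `d₁ d₂ − d = c v (d₂ − d)` read in `ℤ/4`
  have hid4 : ((γ : SL(2, ℤ)) 1 0 * v + (γ : SL(2, ℤ)) 1 1 * u) * (d₂ : ℤ) - (γ : SL(2, ℤ)) 1 1 =
      (γ : SL(2, ℤ)) 1 0 * v * ((d₂ : ℤ) - (γ : SL(2, ℤ)) 1 1) := by linear_combination (γ : SL(2, ℤ)) 1 1 * huv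
  have hcd : (2 : ℤ) ∣ (γ : SL(2, ℤ)) 1 0 → ¬ (2 : ℤ) ∣ (γ : SL(2, ℤ)) 1 1 := by
    intro h2c h2d
    have hdet := entry_det γ
    have : (2 : ℤ) ∣ (γ : SL(2, ℤ)) 0 0 * (γ : SL(2, ℤ)) 1 1 - (γ : SL(2, ℤ)) 0 1 * (γ : SL(2, ℤ)) 1 0 :=
      dvd_sub (h2d.mul_left _) (h2c.mul_left _)
    rw [hdet] at this
    exact absurd (Int.le_of_dvd one_pos this) (by norm_num)
  have key4 : ∀ C D D2 V D1 : ZMod 4, D1 * D2 - D = C * V * (D2 - D) →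
      D2 = (if D = 1 then 3 else 1) → (C = 0 → D = 1) → ((C = 0 ∨ C = 2) → (D = 1 ∨ D = 3)) →
      C * (D2 - D) = 0 → D1 = 3 := by decide
  have hD2 : ((d₂ : ℤ) : ZMod 4) = if (((γ : SL(2, ℤ)) 1 1 : ℤ) : ZMod 4) = 1 then 3 else 1 := by
    have h := ((ZMod.intCast_eq_intCast_iff_dvd_sub (r₄ : ℤ) d₂ 4).mpr hd₂4).symm
    rw [h]
    simp only [r₄]
    by_cases hd1 : (4 : ℤ) ∣ (γ : SL(2, ℤ)) 1 1 - 1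
    · rw [if_pos hd1, if_pos]
      · norm_num
      · have := ((ZMod.intCast_eq_intCast_iff_dvd_sub 1 ((γ : SL(2, ℤ)) 1 1) 4).mpr hd1).symm
        simpa using this
    · rw [if_neg hd1, if_neg]
      · norm_num
      · intro h
        exact hd1 ((ZMod.intCast_eq_intCast_iff_dvd_sub 1 ((γ : SL(2, ℤ)) 1 1) 4).mp (by simpa using h.symm))
  have hC0 : ((((γ : SL(2, ℤ)) 1 0 : ℤ) : ZMod 4) = 0 → ((((γ : SL(2, ℤ)) 1 1 : ℤ) : ZMod 4)) = 1) := by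
    intro h0
    have h4c : (4 : ℤ) ∣ (γ : SL(2, ℤ)) 1 0 := (ZMod.intCast_zmod_eq_zero_iff_dvd _ 4).mp h0
    have := ((ZMod.intCast_eq_intCast_iff_dvd_sub 1 ((γ : SL(2, ℤ)) 1 1) 4).mpr (h4 h4c)).symm
    simpa using this
  have hCD : ((((γ : SL(2, ℤ)) 1 0 : ℤ) : ZMod 4) = 0 ∨ (((γ : SL(2, ℤ)) 1 0 : ℤ) : ZMod 4) = 2) →
      ((((γ : SL(2, ℤ)) 1 1 : ℤ) : ZMod 4) = 1 ∨ (((γ : SL(2, ℤ)) 1 1 : ℤ) : ZMod 4) = 3) := by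
    intro h
    have h2c : (2 : ℤ) ∣ (γ : SL(2, ℤ)) 1 0 := by
      rcases h with h | h
      · exact (show (2 : ℤ) ∣ 4 by norm_num).trans ((ZMod.intCast_zmod_eq_zero_iff_dvd _ 4).mp h)
      · have := (ZMod.intCast_eq_intCast_iff_dvd_sub 2 ((γ : SL(2, ℤ)) 1 0) 4).mp (by simpa using h.symm)
        have := dvd_add ((show (2 : ℤ) ∣ 4 by norm_num).trans this) (dvd_refl (2 : ℤ))
        simpa using this
    have hodd := hcd h2c
    have key : ∀ D : ZMod 4, D ≠ 0 → D ≠ 2 → D = 1 ∨ D = 3 := by decide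
    refine key _ (fun h0 ↦ hodd ?_) (fun h2 ↦ hodd ?_)
    · exact (show (2 : ℤ) ∣ 4 by norm_num).trans ((ZMod.intCast_zmod_eq_zero_iff_dvd _ 4).mp h0)
    · have := (ZMod.intCast_eq_intCast_iff_dvd_sub 2 ((γ : SL(2, ℤ)) 1 1) 4).mp (by simpa using h2.symm)
      have := dvd_add ((show (2 : ℤ) ∣ 4 by norm_num).trans this) (dvd_refl (2 : ℤ))
      simpa using this
  have hmod4₁ : (4 : ℤ) ∣ (γ : SL(2, ℤ)) 1 0 * ((d₂ : ℤ) - (γ : SL(2, ℤ)) 1 1) →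
      (4 : ℤ) ∣ ((γ : SL(2, ℤ)) 1 0 * v + (γ : SL(2, ℤ)) 1 1 * u) - 3 := by
    intro h
    have hid4' := congrArg (fun z : ℤ ↦ (z : ZMod 4)) hid4
    push_cast at hid4'
    have h0 : ((((γ : SL(2, ℤ)) 1 0 : ℤ) : ZMod 4)) * (((d₂ : ℤ) : ZMod 4) - (((γ : SL(2, ℤ)) 1 1 : ℤ) : ZMod 4)) = 0 := by
      have := (ZMod.intCast_zmod_eq_zero_iff_dvd _ 4).mpr h
      push_cast at this
      exact this
    have := key4 _ _ _ _ _ hid4' hD2 hC0 hCD h0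
    have h1 := (ZMod.intCast_eq_intCast_iff_dvd_sub 3 ((γ : SL(2, ℤ)) 1 0 * v + (γ : SL(2, ℤ)) 1 1 * u) 4).mp
      (by push_cast; exact this.symm)
    exact h1
  refine ⟨γ₁, γ₂, (inv_mul_cancel_right γ γ₂).symm, ⟨?_, ?_, ?_, ?_⟩, ⟨?_, ?_, ?_, ?_⟩⟩
  · -- `c₁ ≠ 0`
    rw [e1_10]
    refine mul_ne_zero hc (sub_ne_zero.mpr fun h ↦ hd₂d p hpS ?_)
    rw [h, sub_self]; exact dvd_zero _
  · rw [e1_11]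
    exact fun h ↦ hd₂d p hpS (hkey p hpc h)
  · intro r hr hr2 hrp hrc
    rw [e1_11]
    rw [e1_10] at hrc
    have hrc' : (r : ℤ) ∣ (γ : SL(2, ℤ)) 1 0 := by
      rcases (Int.prime_iff_natAbs_prime.mpr (by simpa using hr)).dvd_or_dvd hrc with h | h
      · exact h
      · exact absurd h (hd₂d r (hrS r hr hr2 hrp))
    exact fun h ↦ hd₂d r (hrS r hr hr2 hrp) (hkey r hrc' h)
  · rw [e1_10, e1_11]
    exact hmod4₁
  · rw [e2_10]; exact hc
  · rw [e2_11]; exact hd₂1 p hpS hpc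
  · intro r hr hr2 hrp hrc
    rw [e2_11]
    rw [e2_10] at hrc
    exact hd₂1 r (hrS r hr hr2 hrp) hrc
  · rw [e2_10, e2_11]
    intro h4c
    have hd1 := h4 h4c
    have : (r₄ : ℤ) = 3 := by simp only [r₄, if_pos hd1]; norm_num
    rw [this] at hd₂4
    exact hd₂4

end Splitting4

/-! ### `γ⁴` always satisfies the side condition at `4` -/

section PowFour4

/-- In `SL₂(ℤ/4)`: if `(A⁴)₁₀ = 0` then `(A⁴)₁₁ = 1` (finite check). [folklore] -/
theorem zmod4_pow_four (A : Matrix (Fin 2) (Fin 2) (ZMod 4)) (hA : A.det = 1)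
    (h : (A ^ 4) 1 0 = 0) : (A ^ 4) 1 1 = 1 := by
  obtain ⟨a, b, c, d, rfl⟩ : ∃ a b c d : ZMod 4, A = !![a, b; c, d] :=
    ⟨A 0 0, A 0 1, A 1 0, A 1 1, Matrix.eta_fin_two A⟩
  rw [Matrix.det_fin_two_of] at hA
  have h4 : ∀ B : Matrix (Fin 2) (Fin 2) (ZMod 4), B ^ 4 = B * B * B * B := fun B ↦ by
    rw [pow_succ, pow_succ, pow_succ, pow_one]
  rw [h4] at h ⊢
  simp only [Matrix.mul_fin_two, Matrix.of_apply, Matrix.cons_val', Matrix.cons_val_zero,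
    Matrix.cons_val_one] at h ⊢
  revert a b c d
  decide

/-- **For every `γ ∈ SL(2, ℤ)`: `4 ∣ (γ⁴)₁₀ ⟹ 4 ∣ (γ⁴)₁₁ − 1`** (reduce modulo `4`). [folklore] -/
theorem four_dvd_pow_four_entry (γ : SL(2, ℤ)) (h : (4 : ℤ) ∣ (γ ^ 4) 1 0) :
    (4 : ℤ) ∣ (γ ^ 4) 1 1 - 1 := by
  set f := Int.castRingHom (ZMod 4) with hf
  set A : Matrix (Fin 2) (Fin 2) (ZMod 4) := f.mapMatrix (γ : Matrix (Fin 2) (Fin 2) ℤ) with hA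
  have hdet : A.det = 1 := by
    rw [hA, ← RingHom.map_det, (γ : SL(2, ℤ)).2, map_one]
  have hpow : A ^ 4 = f.mapMatrix ((γ ^ 4 : SL(2, ℤ)) : Matrix (Fin 2) (Fin 2) ℤ) := by
    rw [Matrix.SpecialLinearGroup.coe_pow, map_pow]
  have hentry : ∀ i j : Fin 2, (A ^ 4) i j = (((γ ^ 4 : SL(2, ℤ)) i j : ℤ) : ZMod 4) := by
    intro i j
    rw [hpow]
    rfl
  have h10 : (A ^ 4) 1 0 = 0 := by
    rw [hentry]
    exact (ZMod.intCast_zmod_eq_zero_iff_dvd _ 4).mpr h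
  have h11 := zmod4_pow_four A hdet h10
  rw [hentry] at h11
  have := (ZMod.intCast_eq_intCast_iff_dvd_sub 1 ((γ ^ 4 : SL(2, ℤ)) 1 1) 4).mp (by simpa using h11.symm)
  simpa using this

end PowFour4

end Summit.BirchSwinnertonDyer.BirchSwinnertonDyer.Theorems.ManinFrameResidueProperRTameTwist

end
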